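import Summits.BirchSwinnertonDyer.BirchSwinnertonDyer.Theorems.ManinLocalTwoThreeThreeBlindUnitCube
import Summits.BirchSwinnertonDyer.BirchSwinnertonDyer.Theorems.ManinLocalTwoThreeThreeBlindCertificate
import HarnessLib

/-!
# `3`-blindness of a rational `3`-torsion point ⟺ the intrinsic Kummer cube series is the cube of a unit of `ℤ₃⟦q⟧`

Summit `BirchSwinnertonDyer`, route `ManinLocalTwoThree` (cell bsd-f2-manin), crux C3 `ManinPrimeToThreeAtNine` (stmt-BirchSwinnertonDyer-22968),
stubs NB₃ / (BL) of `Lines/kato_shift_three.lean`.  Refuter-1 §R66 Lemma 1 in the curve's own terms: the `3`-integral lift of the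
intrinsic Kummer cube series `Θ♮_T` (the lead's construction in `…ThreeBlindCertificate`, constant term `−1`) fed to the Gauss lemma
for cubes in `ℤ₃⟦q⟧` (`…ThreeBlindUnitCube`, Weierstrass-preparation uniqueness):

* `exists_padicInt_lift_kummerCubeSeries` — with `3`-integral `a₄♮, a₆♮, X₁, Y₁, α`: a lift `Θ₀ ∈ ℤ₃⟦q⟧` of `Θ♮_T` with `Θ₀(0) = −1`;
* `threeBlind_iff_exists_isUnit_cube_map` — then `ThreeBlind W X₁ Y₁ ↔ ∃ U ∈ ℤ₃⟦q⟧ˣ, U³ ↦ Θ♮_T` (no `Frac` quantifier);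
* `threeBlind_iff_exists_isUnit_cube_map_of_nine_dvd` — at a datum of level `9 ∣ N` the integrality of `E♮` is automatic
  (p3's `exists_padicInt_shortModel_three`), only `X₁, Y₁, α` need to be `3`-integral.

Nothing about BSD, Manin's conjecture or C3 is proved. [cite: Washington1997, Thm. 7.3]
-/

set_option autoImplicit false
set_option linter.dupNamespace false

noncomputable section

open scoped Classical
open PowerSeries WeierstrassCurve Literature.NumberTheory.EllipticCurves Literature.NumberTheory.EllipticCurves.ModularForms
open Summit.BirchSwinnertonDyer.Rank1Residual.ManinAdditive
open Summit.BirchSwinnertonDyer.Rank1Residual.ManinAdditive.CuspidalKummer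
open Summit.BirchSwinnertonDyer.Rank1Residual.ManinAdditive.CuspidalKummerThree

namespace Summit.BirchSwinnertonDyer.BirchSwinnertonDyer.Theorems.ManinLocalTwoThree

/-- **The `3`-integral lift of the intrinsic Kummer cube series.**  With `3`-integral `a₄♮, a₆♮, X₁, Y₁` and tangent slope `α`,
`Θ♮_T = Y♮³ − Y₁ z³ − α (X♮² z − X₁ z³)` read on the `ℤ₃`-model `[0,0,0,a₄♮,a₆♮]` is a power series over `ℤ₃` with constant
term `−1` mapping to `Θ♮_T`. [folklore] -/
theorem exists_padicInt_lift_kummerCubeSeries (W : WeierstrassCurve ℚ)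
    (hA : ‖(((shortModel W 1).a₄ : ℚ) : ℚ_[3])‖ ≤ 1) (hB : ‖(((shortModel W 1).a₆ : ℚ) : ℚ_[3])‖ ≤ 1)
    {X₁ Y₁ : ℚ} (hX : ‖((X₁ : ℚ) : ℚ_[3])‖ ≤ 1) (hY : ‖((Y₁ : ℚ) : ℚ_[3])‖ ≤ 1)
    (hα : ‖((tangentSlope W 1 X₁ Y₁ : ℚ) : ℚ_[3])‖ ≤ 1) :
    ∃ Θ₀ : (ℤ_[3])⟦X⟧, Θ₀.map (PadicInt.Coe.ringHom (p := 3)) = (kummerCubeSeries W 1 X₁ Y₁ X).map (Rat.castHom ℚ_[3]) ∧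
      constantCoeff Θ₀ = -1 := by
  set α := tangentSlope W 1 X₁ Y₁ with hαdef
  set A₀ : ℤ_[3] := ⟨_, hA⟩ with hA₀
  set B₀ : ℤ_[3] := ⟨_, hB⟩ with hB₀
  set V : WeierstrassCurve ℤ_[3] := ⟨0, 0, 0, A₀, B₀⟩ with hVdef
  have hrat : ∀ q : ℚ, algebraMap ℚ ℚ_[3] q = (q : ℚ_[3]) := fun q => by rw [eq_ratCast]
  have hVE : V.map PadicInt.Coe.ringHom = (shortModel W 1).map (algebraMap ℚ ℚ_[3]) := by
    ext <;> simp [hVdef, shortModel, hA₀, hB₀, hrat]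
  set x : ℤ_[3] := ⟨_, hX⟩ with hxdef
  set y : ℤ_[3] := ⟨_, hY⟩ with hydef
  set a : ℤ_[3] := ⟨_, hα⟩ with hadef
  set ΘV : (ℤ_[3])⟦X⟧ := V.formalYMulCube - C y * X ^ 3 - C a * (V.formalXMulSq * X - C x * X ^ 3) with hΘV
  have hmapΘ : PowerSeries.map (Rat.castHom ℚ_[3]) (kummerCubeSeries W 1 X₁ Y₁ X) =
      PowerSeries.map PadicInt.Coe.ringHom ΘV := by
    rw [Subsingleton.elim (Rat.castHom ℚ_[3]) (algebraMap ℚ ℚ_[3])]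
    have hY1 : (shortModel W 1).formalYMulCube = -(shortModel W 1).formalXMulSq := rfl
    have hYV : V.formalYMulCube = -V.formalXMulSq := rfl
    have hXS : PowerSeries.map (algebraMap ℚ ℚ_[3]) (shortModel W 1).formalXMulSq =
        PowerSeries.map PadicInt.Coe.ringHom V.formalXMulSq := by
      rw [map_formalXMulSq, map_formalXMulSq, hVE]
    rw [kummerCubeSeries, X_subst, X_subst, hY1, hΘV, hYV, ← hαdef]
    simp only [smul_eq_C_mul, map_sub, map_neg, map_mul, map_pow, PowerSeries.map_C, PowerSeries.map_X, hXS, hrat]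
    have ex : (PadicInt.Coe.ringHom (p := 3)) x = ((X₁ : ℚ) : ℚ_[3]) := rfl
    have ey : (PadicInt.Coe.ringHom (p := 3)) y = ((Y₁ : ℚ) : ℚ_[3]) := rfl
    have ea : (PadicInt.Coe.ringHom (p := 3)) a = ((α : ℚ) : ℚ_[3]) := rfl
    rw [ex, ey, ea]
  refine ⟨ΘV, hmapΘ.symm, ?_⟩
  -- the constant term maps to `−1`
  have h0 := congrArg (coeff 0) hmapΘ
  rw [coeff_map, coeff_map, coeff_zero_eq_constantCoeff_apply, coeff_zero_eq_constantCoeff_apply,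
    constantCoeff_kummerCubeSeries W 1 X₁ Y₁ (PowerSeries.constantCoeff_X)] at h0
  have h1 : (PadicInt.Coe.ringHom (p := 3)) (constantCoeff ΘV) = (PadicInt.Coe.ringHom (p := 3)) (-1) := by
    rw [← h0]; simp
  exact Subtype.ext (by simpa using h1)

/-- **Blindness is a unit-cube condition (refuter-1 §R66 Lemma 1), intrinsic form.**  With `3`-integral `a₄♮, a₆♮, X₁, Y₁, α`:
`T = (X₁, Y₁)` is `3`-blind iff `Θ♮_T` is the image of `U³` for a UNIT `U` of `ℤ₃⟦q⟧` — the `Frac ℤ₃⟦q⟧` quantifier of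
`IsThreeAdicFracCube` is superfluous. [cite: Washington1997, Thm. 7.3] -/
theorem threeBlind_iff_exists_isUnit_cube_map (W : WeierstrassCurve ℚ)
    (hA : ‖(((shortModel W 1).a₄ : ℚ) : ℚ_[3])‖ ≤ 1) (hB : ‖(((shortModel W 1).a₆ : ℚ) : ℚ_[3])‖ ≤ 1)
    {X₁ Y₁ : ℚ} (hX : ‖((X₁ : ℚ) : ℚ_[3])‖ ≤ 1) (hY : ‖((Y₁ : ℚ) : ℚ_[3])‖ ≤ 1)
    (hα : ‖((tangentSlope W 1 X₁ Y₁ : ℚ) : ℚ_[3])‖ ≤ 1) :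
    ThreeBlind W X₁ Y₁ ↔ ∃ U : (ℤ_[3])⟦X⟧, IsUnit U ∧
      (U ^ 3).map (PadicInt.Coe.ringHom (p := 3)) = (kummerCubeSeries W 1 X₁ Y₁ X).map (Rat.castHom ℚ_[3]) := by
  obtain ⟨Θ₀, hlift, h0⟩ := exists_padicInt_lift_kummerCubeSeries W hA hB hX hY hα
  have hu : IsUnit (constantCoeff Θ₀) := by rw [h0]; exact isUnit_one.neg
  rw [threeBlind_iff_exists_isUnit_cube W X₁ Y₁ Θ₀ hlift hu]
  constructor
  · rintro ⟨U, hU, hΘU⟩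
    exact ⟨U, hU, by rw [← hΘU, hlift]⟩
  · rintro ⟨U, hU, hmap⟩
    refine ⟨U, hU, powerSeries_map_padicInt_injective ?_⟩
    rw [hlift, hmap]

/-- **The same at a datum of level `9 ∣ N`** (additive reduction at `3`: `E♮` is `3`-integral automatically, p3's
`exists_padicInt_shortModel_three`); only `X₁, Y₁, α` are assumed `3`-integral. [cite: Washington1997, Thm. 7.3] -/
theorem threeBlind_iff_exists_isUnit_cube_map_of_nine_dvd (W : WeierstrassCurve ℚ) [W.IsElliptic] [W.IsGloballyMinimal]
    {N : ℕ} [NeZero N] (D : ModularParametrizationData W N) (h9 : 9 ∣ N)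
    {X₁ Y₁ : ℚ} (hX : ‖((X₁ : ℚ) : ℚ_[3])‖ ≤ 1) (hY : ‖((Y₁ : ℚ) : ℚ_[3])‖ ≤ 1)
    (hα : ‖((tangentSlope W 1 X₁ Y₁ : ℚ) : ℚ_[3])‖ ≤ 1) :
    ThreeBlind W X₁ Y₁ ↔ ∃ U : (ℤ_[3])⟦X⟧, IsUnit U ∧
      (U ^ 3).map (PadicInt.Coe.ringHom (p := 3)) = (kummerCubeSeries W 1 X₁ Y₁ X).map (Rat.castHom ℚ_[3]) := by
  obtain ⟨ha3, hN3⟩ := lFunction_three_eq_zero_of_nine_dvd W D.isNewformOf h9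
  obtain ⟨hΔ3, hc₄3⟩ := three_dvd_Δ_and_c₄_of_hasAdditiveReductionAt W
    (hasAdditiveReductionAt_three_of_lFunction_three_eq_zero W ha3 hN3)
  obtain ⟨V, -, -, -, hVE, -, -, -⟩ := exists_padicInt_shortModel_three W hΔ3 hc₄3
  have hrat : ∀ q : ℚ, algebraMap ℚ ℚ_[3] q = (q : ℚ_[3]) := fun q => by rw [eq_ratCast]
  have hA : ‖(((shortModel W 1).a₄ : ℚ) : ℚ_[3])‖ ≤ 1 := by
    have h := congrArg WeierstrassCurve.a₄ hVE
    rw [map_a₄, map_a₄, hrat] at h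
    rw [← h]; exact PadicInt.norm_le_one _
  have hB : ‖(((shortModel W 1).a₆ : ℚ) : ℚ_[3])‖ ≤ 1 := by
    have h := congrArg WeierstrassCurve.a₆ hVE
    rw [map_a₆, map_a₆, hrat] at h
    rw [← h]; exact PadicInt.norm_le_one _
  exact threeBlind_iff_exists_isUnit_cube_map W hA hB hX hY hα

end Summit.BirchSwinnertonDyer.BirchSwinnertonDyer.Theorems.ManinLocalTwoThree

end
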